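import Summits.Ventures.CertifiedManyBodySolver.Downfold.PressureContinuum
import HarnessLib

/-!
# The router word along the computed pressure range, II: words at a vector, junctions, maximal
# decided runs

Venture CertifiedManyBodySolver, cell `pub/hubbard-downfold` (S1 = downfolding front end = ROUTER),
seat hubbard-downfold-mod-2; namespace `Summit.Ventures.CertifiedManyBodySolver.Downfold.Router`.
Continues `Downfold.PressureContinuum` (grid cover, padded hull record, the P.12(e) certificate
`IntervalCert` of ONE sub-interval and its one-sided analogue `ReachCert`). Here the certificates of
consecutive sub-intervals of the grid `a 0, a 1, …` of computed pressures are assembled: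

* `WordHolds T w q` — some row of the table with word `w` holds at the parameter vector `q`;
  `WordHolds.eq` — a consistent table lets at most ONE word hold at a vector.
* **JUNCTION** `IntervalCert.out_eq_of_junction` — two certified sub-intervals sharing a computed
  point carry the SAME word (both rows fire on the shared point box; no order hypothesis);
  `SegCert.out_eq_of_meet` — two certified segments that share any pressure agree.
* **RUN** `out_eq_of_chain` / `wordHolds_on_chain` / `route_point_of_chain` /
  `wordHolds_unique_on_chain` — on a run `[a i, a j]` of consecutive certified sub-intervals all
  interval words agree, that word holds at EVERY pressure of the run, every computed column inside
  the run is routed to it, and no other word holds anywhere on the run: a maximal decided run is ONE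
  P-segment of the D-0099 phase map with one word (the router-side content of a block of
  «interpolated (P.12e)» rows of `router/P-CONTINUUM.tsv` between two «undetermined» ones).
* **(h″) COVERAGE** `wordHolds_of_reaches_meeting` — a segment certified from the left computed
  point on `[a, m]` and one certified from the right on `[m, b]` give one word on `[a, b]`
  (`router/INFLATION-RULES.md` §P.12(h″) «two-structure coverage»; the two reaches cannot carry
  different words).

Everything is PROVED. WHAT THIS IS NOT: a statement about any material; the certificates are
hypotheses whose inputs (monotonicity, sensitivity classes, point boxes) are the SYSTEMATIC
modelling claims of `router/INFLATION-RULES.md` §P — an «interpolated» run inherits exactly the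
standing of its computed end columns.
-/

open Set

namespace Summit.Ventures.CertifiedManyBodySolver.Downfold

namespace Router

variable {ι : Type*} {ω : Type*}

/-! ## §4 The continuum: words at a vector, junctions, runs -/

/-- **The word `w` HOLDS at the parameter vector `q`**: some row of the table with word `w` is
satisfied at `q`. [folklore] -/
@[folklore]
def WordHolds (T : List (Row ι ω)) (w : ω) (q : ι → ℝ) : Prop := ∃ r ∈ T, r.out = w ∧ r.Sat q

/-- **A consistent table lets at most ONE word hold at a vector.** [folklore] -/
theorem WordHolds.eq {T : List (Row ι ω)} (hT : Consistent T) {w w' : ω} {q : ι → ℝ}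
    (h : WordHolds T w q) (h' : WordHolds T w' q) : w = w' := by
  obtain ⟨r, hr, rfl, hs⟩ := h
  obtain ⟨r', hr', rfl, hs'⟩ := h'
  exact hT r hr r' hr' q hs hs'

/-- A segment certificate makes its word hold along the segment. [folklore] -/
theorem SegCert.wordHolds {H : Skel ι} {p : ℝ → ι → ℝ} {a b : ℝ} {r : Row ι ω}
    {T : List (Row ι ω)} (hr : r ∈ T) (c : SegCert H p a b r) :
    ∀ u ∈ Icc a b, WordHolds T r.out (p u) :=
  fun u hu => ⟨r, hr, rfl, c.sat u hu⟩

/-- **JUNCTION.** Two certified sub-intervals `[a, b]` and `[b, c]` sharing the computed point whose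
box is `S₁` carry the SAME word: both rows fire on `S₁`, and a consistent table routes `S₁` to one
word. (No order hypothesis on `a, b, c` is needed.) [folklore] -/
theorem IntervalCert.out_eq_of_junction {T : List (Row ι ω)} (hT : Consistent T)
    {S₀ S₁ S₂ H₀ H₁ : Skel ι} {p : ℝ → ι → ℝ} {a b c : ℝ} {r r' : Row ι ω} (hr : r ∈ T)
    (hr' : r' ∈ T) (c₀ : IntervalCert S₀ S₁ H₀ p a b r) (c₁ : IntervalCert S₁ S₂ H₁ p b c r') :
    r.out = r'.out := by
  have h := (c₀.route_right hT hr).symm.trans (c₁.route_left hT hr')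
  injection h

/-- **Two segment certificates that MEET carry the same word** (consistent table): if `[a, m]` and
`[m', b]` are certified and share a pressure `u`, the two rows agree — the (h″) situation «covered
from both ends» can never print two different words. [folklore] -/
theorem SegCert.out_eq_of_meet {T : List (Row ι ω)} (hT : Consistent T) {H H' : Skel ι}
    {p : ℝ → ι → ℝ} {a m m' b u : ℝ} {r r' : Row ι ω} (hr : r ∈ T) (hr' : r' ∈ T)
    (c : SegCert H p a m r) (c' : SegCert H' p m' b r') (hu : u ∈ Icc a m) (hu' : u ∈ Icc m' b) :
    r.out = r'.out :=
  hT r hr r' hr' (p u) (c.sat u hu) (c'.sat u hu')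

/-- **(h″) COVERAGE.** A segment certified on `[a, m]` (e.g. a reach from the left computed point)
and one certified on `[m, b]` (a reach from the right computed point) give ONE word holding on all
of `[a, b]`. [folklore] -/
theorem wordHolds_of_reaches_meeting {T : List (Row ι ω)} (hT : Consistent T) {H H' : Skel ι}
    {p : ℝ → ι → ℝ} {a m b : ℝ} {r r' : Row ι ω} (hr : r ∈ T) (hr' : r' ∈ T) (ham : a ≤ m)
    (hmb : m ≤ b) (c : SegCert H p a m r) (c' : SegCert H' p m b r') :
    ∀ u ∈ Icc a b, WordHolds T r.out (p u) := by
  have hw : r.out = r'.out :=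
    SegCert.out_eq_of_meet hT hr hr' c c' (right_mem_Icc.2 ham) (left_mem_Icc.2 hmb)
  refine Inflation.forall_Icc_of_forall_Icc_two (c.wordHolds hr) fun u hu => ?_
  rw [hw]
  exact c'.wordHolds hr' u hu

section Chain

variable {T : List (Row ι ω)} {S H : ℕ → Skel ι} {p : ℝ → ι → ℝ} {a : ℕ → ℝ} {ρ : ℕ → Row ι ω}
  {i j : ℕ}

/-- **RUN OF CERTIFIED SUB-INTERVALS — all interval words agree.** Point skeletons `S k` at the
computed pressures `a k`, interval records `H k` and rows `ρ k ∈ T` certifying every sub-interval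
`[a k, a (k+1)]`, `i ≤ k < j`: every interval word of the run equals the first one. [folklore] -/
theorem out_eq_of_chain (hT : Consistent T) (hρ : ∀ k, i ≤ k → k < j → ρ k ∈ T)
    (cert : ∀ k, i ≤ k → k < j → IntervalCert (S k) (S (k + 1)) (H k) p (a k) (a (k + 1)) (ρ k)) :
    ∀ k, i ≤ k → k < j → (ρ k).out = (ρ i).out := by
  intro k hik
  induction k, hik using Nat.le_induction with
  | base => exact fun _ => rfl
  | succ n hin ih =>
    intro hnj
    have hn : n < j := Nat.lt_of_succ_lt hnj
    rw [← IntervalCert.out_eq_of_junction hT (hρ n hin hn) (hρ (n + 1) (Nat.le_succ_of_le hin) hnj)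
      (cert n hin hn) (cert (n + 1) (Nat.le_succ_of_le hin) hnj)]
    exact ih hn

/-- **RUN OF CERTIFIED SUB-INTERVALS — the word holds on the whole run.** Under the hypotheses of
`out_eq_of_chain` with `i < j`, the common word holds at EVERY pressure of `[a i, a j]`: a maximal
decided run is one P-segment of the phase map. [folklore] -/
theorem wordHolds_on_chain (hT : Consistent T) (hij : i < j) (hρ : ∀ k, i ≤ k → k < j → ρ k ∈ T)
    (cert : ∀ k, i ≤ k → k < j → IntervalCert (S k) (S (k + 1)) (H k) p (a k) (a (k + 1)) (ρ k)) :
    ∀ u ∈ Icc (a i) (a j), WordHolds T (ρ i).out (p u) :=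
  Inflation.forall_Icc_of_forall_Icc_succ hij fun k hik hkj u hu =>
    ⟨ρ k, hρ k hik hkj, out_eq_of_chain hT hρ cert k hik hkj, (cert k hik hkj).sat u hu⟩

/-- **RUN OF CERTIFIED SUB-INTERVALS — every computed column inside the run is routed to the run's
word** (the `computed` rows of a `P-CONTINUUM.tsv` block agree with its «interpolated» rows).
[folklore] -/
theorem route_point_of_chain (hT : Consistent T) (hij : i < j) (hρ : ∀ k, i ≤ k → k < j → ρ k ∈ T)
    (cert : ∀ k, i ≤ k → k < j → IntervalCert (S k) (S (k + 1)) (H k) p (a k) (a (k + 1)) (ρ k))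
    {k : ℕ} (hik : i ≤ k) (hkj : k ≤ j) : route T (S k) = .table (ρ i).out := by
  rcases hkj.lt_or_eq with hlt | rfl
  · rw [← out_eq_of_chain hT hρ cert k hik hlt]
    exact (cert k hik hlt).route_left hT (hρ k hik hlt)
  · obtain ⟨m, rfl⟩ := Nat.exists_eq_succ_of_ne_zero (Nat.ne_zero_of_lt hij)
    have him : i ≤ m := Nat.le_of_lt_succ hij
    rw [← out_eq_of_chain hT hρ cert m him (Nat.lt_succ_self m)]
    exact (cert m him (Nat.lt_succ_self m)).route_right hT (hρ m him (Nat.lt_succ_self m))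

/-- **The word is UNIQUE along the run**: whatever word holds at a pressure of `[a i, a j]` is the
run's word (consistent table). [folklore] -/
theorem wordHolds_unique_on_chain (hT : Consistent T) (hij : i < j)
    (hρ : ∀ k, i ≤ k → k < j → ρ k ∈ T)
    (cert : ∀ k, i ≤ k → k < j → IntervalCert (S k) (S (k + 1)) (H k) p (a k) (a (k + 1)) (ρ k))
    {u : ℝ} (hu : u ∈ Icc (a i) (a j)) {w : ω} (hw : WordHolds T w (p u)) : w = (ρ i).out :=
  hw.eq hT (wordHolds_on_chain hT hij hρ cert u hu)

end Chain

/-! ### Restriction and gluing of certificates (the analytic counterpart of grid refinement /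
coarsening: `PressureContinuumRefine.lookup_insertCol_of_not_mem_gap` is the record-level statement) -/

section Glue

variable {S₁ S₂ Sc H H₁ H₂ : Skel ι} {p : ℝ → ι → ℝ} {a b c : ℝ} {r : Row ι ω}

/-- **RESTRICTION to a left sub-interval.** A certificate on `[a, b]` and a point skeleton `Sc` at an
intermediate pressure `c ≤ b` that the record `H` inflates give a certificate on `[a, c]` (a new
computed column INSIDE a certified interval inherits its word — provided its box sits in the record).
[folklore] -/
theorem IntervalCert.restrict_left (cert : IntervalCert S₁ S₂ H p a b r) (hcb : c ≤ b)
    (hSc : Sc.Incl H) : IntervalCert S₁ Sc H p a c r where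
  path := fun u hu => cert.path u ⟨hu.1, hu.2.trans hcb⟩
  fires := cert.fires
  incl_left := cert.incl_left
  incl_right := hSc

/-- **RESTRICTION to a right sub-interval** (`a ≤ c`). [folklore] -/
theorem IntervalCert.restrict_right (cert : IntervalCert S₁ S₂ H p a b r) (hac : a ≤ c)
    (hSc : Sc.Incl H) : IntervalCert Sc S₂ H p c b r where
  path := fun u hu => cert.path u ⟨hac.trans hu.1, hu.2⟩
  fires := cert.fires
  incl_left := hSc
  incl_right := cert.incl_right

/-- **GLUING two certificates of the SAME row at a shared computed pressure** `c ∈ [a, b]`: the hull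
of the two records is a record for `[a, b]` (the row fires on the hull of two skeletons it fires on —
`Row.fires_hull`; the path is in one of the two records at every pressure — the two-piece cover, which
needs no order hypothesis on `a, c, b`).
Coarsening a grid never loses a word that both halves carried by the same row. [folklore] -/
theorem IntervalCert.glue (c₁ : IntervalCert S₁ Sc H₁ p a c r)
    (c₂ : IntervalCert Sc S₂ H₂ p c b r) : IntervalCert S₁ S₂ (H₁.hull H₂) p a b r where
  path := Inflation.forall_Icc_of_forall_Icc_two
    (fun u hu => (Skel.incl_hull_left H₁ H₂).mem_of_mem (c₁.path u hu))
    (fun u hu => (Skel.incl_hull_right H₁ H₂).mem_of_mem (c₂.path u hu))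
  fires := Row.fires_hull c₁.fires c₂.fires
  incl_left := c₁.incl_left.trans (Skel.incl_hull_left H₁ H₂)
  incl_right := c₂.incl_right.trans (Skel.incl_hull_right H₁ H₂)

/-- Gluing needs the SAME row on both halves; with DIFFERENT rows of a consistent table the two halves
still carry the same WORD (the junction theorem), so the word — not the certificate — extends over
`[a, b]`. [folklore] -/
theorem wordHolds_of_two_certs {T : List (Row ι ω)} (hT : Consistent T) {r' : Row ι ω}
    (hr : r ∈ T) (hr' : r' ∈ T) (c₁ : IntervalCert S₁ Sc H₁ p a c r)
    (c₂ : IntervalCert Sc S₂ H₂ p c b r') (hac : a ≤ c) (hcb : c ≤ b) :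
    ∀ u ∈ Icc a b, WordHolds T r.out (p u) :=
  wordHolds_of_reaches_meeting hT hr hr' hac hcb c₁.toSegCert c₂.toSegCert

end Glue

end Router

end Summit.Ventures.CertifiedManyBodySolver.Downfold
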